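import Summits.QuantumFields.YangMills.Theorems.FlatTubeReductionFibredBOCross
import HarnessLib

/-!
# CROSS block with an APPROXIMATE fibre profile: the door's (P4) needs no exact fibre eigenfunction (model side of the RATE twin)
# (route `FlatTubeReduction`, crux K1 `NearFlatRatioLaw` stmt-QuantumFields-24720, registered stub `stub_boRate` = FCL 23943's `BORateAll`; line «borate»;
# rung R2b1 = RECORD-label femto gap; no summit statement is proved here)

Seat `ym-line-ftr-p1` g7 (prover).  g6's CROSS block `sq_fibredForm_prod_le_of_orth` (p632604) asks the fibre profile `Ω_c` to be EXACTLY `K_c`-orthogonal to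
the fibres of `χ` (`B_{c,c}(Ω_c, χ_c) = 0`), i.e. `Ω_c` = the exact top eigenfunction of the c-frozen fibre kernel (`fibrePair_profile_fibredOrth_eq_zero`, p633526)
— whose measurable dependence on `c` for a NON-Gaussian (exact Boltzmann) fibre weight is a selection problem the chart seat should not have to solve.  Here the
hypothesis is relaxed to a RESIDUAL bound `|B_{c,c}(Ω_c, χ_c)| ≤ ε(c)·‖χ_c‖_{L²(π)}` — what an EXPLICIT approximate eigenfunction (the c-frozen GAUSSIAN = Mehler ground
state of the quadratic stiff form, lane A `…MehlerGap`/`…StiffHessian`) satisfies with `ε ≍ β^{-1/2}·polylog` (cubic anharmonicity), still `≪ λ_b(L³β) ≍ β^{-1/3}`: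
* ★ `abs_fibrePair_le_add_of_res` — `|B_{c,c'}(Ω_c, h)| ≤ ‖S_cΩ_c − S_{c'}Ω_{c'}‖·√E_{c'}(h) + |B_{c',c'}(Ω_{c'}, h)|` (transport + residual);
* ★★ `sq_fibredForm_prod_le_of_res` — CROSS (P4) with residual: fibre gap `E_c(χ_c) ≤ Λ₁‖χ_c‖²`, rows `≤ r`, `∫k(c,c')·transportSq ≤ τ(c)`, `∫k(c,c')ε(c')² ≤ τ'(c)` ⇒
  `T(f⊗Ω, χ)² ≤ 2·r·(Λ₁∫f²τ + ∫f²τ')·‖χ‖²` — the off-diagonal amplitude is `O(√τ + ε)`; with `τ = O(β^{-1})`, `ε = O(β^{-1/2+})` this is `O(β^{-1/2+})`,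
  within the `O(u)`, `u = λ_b(L³β) ≍ β^{-1/3}`, that the door's (P4) allows.
So the rate twin runs with the explicit Gaussian fibre profile throughout ((P1) exact for ANY normalised profile, DIAG/FLOOR for ANY profile — g6 — and now CROSS);
`Cruxes/NearFlatRatioLaw/Lines/borate-rate-uniformity-g7.md`.
HONEST FRAMING: elementary measure theory (Cauchy–Schwarz, Fubini, AM–GM) for the registered stub of a crux of the CONDITIONAL reduction route to the femto rung R2b1
(RECORD label); the chart supplying `k, s, Ω, ε, τ` is OPEN (route RED lane A C4-CORE + the rate twin); nothing here is infinite volume, a continuum limit or the Clay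
mass gap.  No definitions, no `sorry`.

## References
* B. Helffer, *Spectral Theory and its Applications*, CUP 2013, Lemma 7.1 (Schur's test) — [cite: Helffer2013, Lemma 7.1 pp.77–78].
* S. J. Gustafson, I. M. Sigal, *Mathematical Concepts of Quantum Mechanics*, Springer 2003, §12 (Born–Oppenheimer) — [cite: GustafsonSigal2003, §12].
-/

set_option autoImplicit false

noncomputable section

open MeasureTheory

namespace Summit.QuantumFields.YangMills.Theorems.FemtoTransferGap.FibredBO

variable {C Q Z : Type*} [MeasurableSpace C] [MeasurableSpace Q] [MeasurableSpace Z]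
variable {ν : Measure C} {π : Measure Q} {ρ : Measure Z} [SFinite ν] [SFinite π] [SFinite ρ]
variable {k : C → C → ℝ} {s : C → Q → Z → ℝ}

omit [MeasurableSpace C] [SFinite π] [SFinite ρ] in
/-- ★ **Fibre cross pairing with a residual**: for ANY fibre profile,
`|B_{c,c'}(Ω_c, h)| ≤ ‖S_cΩ_c − S_{c'}Ω_{c'}‖·√E_{c'}(h) + |B_{c',c'}(Ω_{c'}, h)|` — transport of the profile from `c'` to `c` plus the fibrewise residual
pairing (zero for the exact frozen eigenfunction and `h ⊥ Ω_{c'}`, small for an approximate one). [folklore] -/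
theorem abs_fibrePair_le_add_of_res (Ω : C → Q → ℝ) (c c' : C) (h : Q → ℝ)
    (hΩc : MemLp (halfT π s c (Ω c)) 2 ρ) (hΩc' : MemLp (halfT π s c' (Ω c')) 2 ρ) (hh : MemLp (halfT π s c' h) 2 ρ) :
    |fibrePair π ρ s c c' (Ω c) h| ≤
      Real.sqrt (transportSq π ρ s Ω c c') * Real.sqrt (fibreEnergy π ρ s c' h) + |fibrePair π ρ s c' c' (Ω c') h| := by
  have hsub : MemLp (fun z => halfT π s c (Ω c) z - halfT π s c' (Ω c') z) 2 ρ := hΩc.sub hΩc'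
  have i1 : Integrable (fun z => (halfT π s c (Ω c) z - halfT π s c' (Ω c') z) * halfT π s c' h z) ρ := hsub.integrable_mul hh
  have i2 : Integrable (fun z => halfT π s c' (Ω c') z * halfT π s c' h z) ρ := hΩc'.integrable_mul hh
  have hsplit : fibrePair π ρ s c c' (Ω c) h =
      (∫ z, (halfT π s c (Ω c) z - halfT π s c' (Ω c') z) * halfT π s c' h z ∂ρ) + fibrePair π ρ s c' c' (Ω c') h := by
    unfold fibrePair
    calc ∫ z, halfT π s c (Ω c) z * halfT π s c' h z ∂ρ
        = ∫ z, ((halfT π s c (Ω c) z - halfT π s c' (Ω c') z) * halfT π s c' h z + halfT π s c' (Ω c') z * halfT π s c' h z) ∂ρ :=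
          integral_congr_ae (ae_of_all _ fun z => by ring)
      _ = (∫ z, (halfT π s c (Ω c) z - halfT π s c' (Ω c') z) * halfT π s c' h z ∂ρ) +
            ∫ z, halfT π s c' (Ω c') z * halfT π s c' h z ∂ρ := integral_add i1 i2
  rw [hsplit]
  refine (abs_add_le _ _).trans (add_le_add ?_ le_rfl)
  exact abs_integral_mul_le_sqrt_mul_sqrt hsub hh

omit [SFinite ρ] in
/-- ★★ **CROSS block (the door's (P4)) with an APPROXIMATE fibre profile.**  Let the fibre profiles `Ω_c` satisfy the RESIDUAL bound
`|B_{c,c}(Ω_c, χ(c,·))| ≤ ε(c)·‖χ(c,·)‖_{L²(π)}` (instead of exact `K_c`-orthogonality), let every fibre of `χ` obey the gap bound `E_c(χ(c,·)) ≤ Λ₁‖χ(c,·)‖²`, let the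
symmetric nonnegative slow kernel have rows `≤ r`, and let `τ, τ'` bound the kinetic averages of the transport defect and of the squared residual:
`∫k(c,c')‖S_cΩ_c − S_{c'}Ω_{c'}‖² dν(c') ≤ τ(c)`, `∫k(c,c')ε(c')² dν(c') ≤ τ'(c)`.  Then for every slow profile `f`:
`T(f⊗Ω, χ)² ≤ 2·r·(Λ₁∫f²τ + ∫f²τ')·‖χ‖²_{L²(ν⊗π)}` — the off-diagonal amplitude is `O(√τ + ε)`, no gap spent. [folklore] [cite: Helffer2013, Lemma 7.1 pp.77–78]
[cite: GustafsonSigal2003, §12] -/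
theorem sq_fibredForm_prod_le_of_res (hk : ∀ c c', 0 ≤ k c c') (hksymm : ∀ c c', k c c' = k c' c) {r Λ₁ : ℝ} (hr : 0 ≤ r) (hΛ₁ : 0 ≤ Λ₁)
    (hrow : ∀ᵐ c ∂ν, ∫ c', k c c' ∂ν ≤ r) (f : C → ℝ) (Ω : C → Q → ℝ) (τ τ' ε : C → ℝ) (hε : ∀ c, 0 ≤ ε c) {χ : C × Q → ℝ}
    (hΩ : ∀ c, MemLp (halfT π s c (Ω c)) 2 ρ) (hχ : ∀ c, MemLp (halfT π s c fun q => χ (c, q)) 2 ρ)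
    (hχ2 : Integrable (fun x => χ x ^ 2) (ν.prod π)) (hfτ : Integrable (fun c => f c ^ 2 * τ c) ν) (hfτ' : Integrable (fun c => f c ^ 2 * τ' c) ν)
    (hgap : ∀ c, fibreEnergy π ρ s c (fun q => χ (c, q)) ≤ Λ₁ * ∫ q, χ (c, q) ^ 2 ∂π)
    (hres : ∀ c, |fibrePair π ρ s c c (Ω c) (fun q => χ (c, q))| ≤ ε c * Real.sqrt (∫ q, χ (c, q) ^ 2 ∂π))
    (hτ : ∀ c, ∫ c', k c c' * transportSq π ρ s Ω c c' ∂ν ≤ τ c) (hτ' : ∀ c, ∫ c', k c c' * ε c' ^ 2 ∂ν ≤ τ' c)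
    (hI : Integrable (fun p : C × C => k p.1 p.2 * fibrePair π ρ s p.1 p.2 (fun q => f p.1 * Ω p.1 q) (fun q => χ (p.2, q))) (ν.prod ν))
    (hJ : Integrable (fun p : C × C => k p.1 p.2 * ((|f p.1| * (Real.sqrt (Λ₁ * transportSq π ρ s Ω p.1 p.2) + ε p.2)) *
      Real.sqrt (∫ q, χ (p.2, q) ^ 2 ∂π))) (ν.prod ν))
    (hJ₁ : Integrable (fun p : C × C => k p.1 p.2 * transportSq π ρ s Ω p.1 p.2 * f p.1 ^ 2) (ν.prod ν))
    (hJ₁' : Integrable (fun p : C × C => k p.1 p.2 * ε p.2 ^ 2 * f p.1 ^ 2) (ν.prod ν))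
    (hJ₂ : Integrable (fun p : C × C => k p.1 p.2 * ∫ q, χ (p.2, q) ^ 2 ∂π) (ν.prod ν)) :
    fibredForm ν π ρ k s (fun x => f x.1 * Ω x.1 x.2) χ ^ 2 ≤
      2 * r * (Λ₁ * (∫ c, f c ^ 2 * τ c ∂ν) + ∫ c, f c ^ 2 * τ' c ∂ν) * ∫ x, χ x ^ 2 ∂(ν.prod π) := by
  -- abbreviations
  set T : C → C → ℝ := fun c c' => transportSq π ρ s Ω c c' with hT
  set m2 : C → ℝ := fun c => ∫ q, χ (c, q) ^ 2 ∂π with hm2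
  set a : C → C → ℝ := fun c c' => Real.sqrt (Λ₁ * T c c') + ε c' with ha
  have hm2nn : ∀ c, 0 ≤ m2 c := fun c => integral_nonneg fun _ => sq_nonneg _
  have hTnn : ∀ c c', 0 ≤ T c c' := fun c c' => transportSq_nonneg Ω c c'
  have hann : ∀ c c', 0 ≤ a c c' := fun c c' => add_nonneg (Real.sqrt_nonneg _) (hε c')
  have hasq : ∀ c c', a c c' ^ 2 ≤ 2 * (Λ₁ * T c c' + ε c' ^ 2) := fun c c' => by
    have h1 : Real.sqrt (Λ₁ * T c c') ^ 2 = Λ₁ * T c c' := Real.sq_sqrt (mul_nonneg hΛ₁ (hTnn c c'))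
    have h2 : 0 ≤ (Real.sqrt (Λ₁ * T c c') - ε c') ^ 2 := sq_nonneg _
    simp only [ha]
    nlinarith
  -- Step A: pointwise bound on the integrand
  have hpt : ∀ p : C × C, |k p.1 p.2 * fibrePair π ρ s p.1 p.2 (fun q => f p.1 * Ω p.1 q) (fun q => χ (p.2, q))| ≤
      k p.1 p.2 * ((|f p.1| * a p.1 p.2) * Real.sqrt (m2 p.2)) := by
    intro p
    rw [fibrePair_const_mul_left, abs_mul, abs_of_nonneg (hk p.1 p.2), abs_mul]
    refine mul_le_mul_of_nonneg_left ?_ (hk p.1 p.2)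
    have h1 := abs_fibrePair_le_add_of_res (π := π) (ρ := ρ) (s := s) Ω p.1 p.2 (fun q => χ (p.2, q)) (hΩ p.1) (hΩ p.2) (hχ p.2)
    have h2 : Real.sqrt (fibreEnergy π ρ s p.2 fun q => χ (p.2, q)) ≤ Real.sqrt (Λ₁ * m2 p.2) := Real.sqrt_le_sqrt (hgap p.2)
    have h3 : Real.sqrt (Λ₁ * m2 p.2) = Real.sqrt Λ₁ * Real.sqrt (m2 p.2) := Real.sqrt_mul hΛ₁ _
    have h4 : Real.sqrt (Λ₁ * T p.1 p.2) = Real.sqrt Λ₁ * Real.sqrt (T p.1 p.2) := Real.sqrt_mul hΛ₁ _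
    have h5 := hres p.2
    have step : |fibrePair π ρ s p.1 p.2 (Ω p.1) fun q => χ (p.2, q)| ≤ a p.1 p.2 * Real.sqrt (m2 p.2) := by
      calc |fibrePair π ρ s p.1 p.2 (Ω p.1) fun q => χ (p.2, q)|
          ≤ Real.sqrt (T p.1 p.2) * Real.sqrt (fibreEnergy π ρ s p.2 fun q => χ (p.2, q)) + |fibrePair π ρ s p.2 p.2 (Ω p.2) fun q => χ (p.2, q)| := h1
        _ ≤ Real.sqrt (T p.1 p.2) * Real.sqrt (Λ₁ * m2 p.2) + ε p.2 * Real.sqrt (m2 p.2) :=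
            add_le_add (mul_le_mul_of_nonneg_left h2 (Real.sqrt_nonneg _)) h5
        _ = a p.1 p.2 * Real.sqrt (m2 p.2) := by simp only [ha]; rw [h3, h4]; ring
    calc |f p.1| * |fibrePair π ρ s p.1 p.2 (Ω p.1) fun q => χ (p.2, q)| ≤ |f p.1| * (a p.1 p.2 * Real.sqrt (m2 p.2)) :=
          mul_le_mul_of_nonneg_left step (abs_nonneg _)
      _ = (|f p.1| * a p.1 p.2) * Real.sqrt (m2 p.2) := by ring
  -- Step B
  have hB : |fibredForm ν π ρ k s (fun x => f x.1 * Ω x.1 x.2) χ| ≤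
      ∫ p, k p.1 p.2 * ((|f p.1| * a p.1 p.2) * Real.sqrt (m2 p.2)) ∂(ν.prod ν) := by
    unfold fibredForm
    rw [integral_integral hI]
    exact (abs_integral_le_integral_abs).trans (integral_mono hI.abs hJ hpt)
  -- Step C: the two Fubini estimates
  have hA : ∫ p, k p.1 p.2 * T p.1 p.2 * f p.1 ^ 2 ∂(ν.prod ν) ≤ ∫ c, f c ^ 2 * τ c ∂ν := by
    rw [integral_prod _ hJ₁]
    refine integral_mono_ae hJ₁.integral_prod_left hfτ (ae_of_all _ fun c => ?_)
    dsimp only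
    have e : ∫ c', k c c' * T c c' * f c ^ 2 ∂ν = (∫ c', k c c' * T c c' ∂ν) * f c ^ 2 := by rw [← integral_mul_const]
    rw [e, mul_comm]
    exact mul_le_mul_of_nonneg_left (hτ c) (sq_nonneg _)
  have hA' : ∫ p, k p.1 p.2 * ε p.2 ^ 2 * f p.1 ^ 2 ∂(ν.prod ν) ≤ ∫ c, f c ^ 2 * τ' c ∂ν := by
    rw [integral_prod _ hJ₁']
    refine integral_mono_ae hJ₁'.integral_prod_left hfτ' (ae_of_all _ fun c => ?_)
    dsimp only
    have e : ∫ c', k c c' * ε c' ^ 2 * f c ^ 2 ∂ν = (∫ c', k c c' * ε c' ^ 2 ∂ν) * f c ^ 2 := by rw [← integral_mul_const]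
    rw [e, mul_comm]
    exact mul_le_mul_of_nonneg_left (hτ' c) (sq_nonneg _)
  have hBB : ∫ p, k p.1 p.2 * m2 p.2 ∂(ν.prod ν) ≤ r * ∫ x, χ x ^ 2 ∂(ν.prod π) := by
    rw [integral_prod_symm _ hJ₂]
    have hm : Integrable (fun c' => ∫ c, k c c' * m2 c' ∂ν) ν := hJ₂.swap.integral_prod_left
    have hm2i : Integrable m2 ν := (hχ2.integral_prod_left).congr (ae_of_all _ fun c => rfl)
    have hcol : ∀ᵐ c' ∂ν, ∫ c, k c c' ∂ν ≤ r := by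
      filter_upwards [hrow] with c' hc'
      have e : (fun c => k c c') = fun c => k c' c := funext fun c => hksymm c c'
      rw [e]; exact hc'
    calc ∫ c', ∫ c, k c c' * m2 c' ∂ν ∂ν ≤ ∫ c', r * m2 c' ∂ν := by
          refine integral_mono_ae hm (hm2i.const_mul r) ?_
          filter_upwards [hcol] with c' hc'
          rw [integral_mul_const]
          exact mul_le_mul_of_nonneg_right hc' (hm2nn c')
      _ = r * ∫ c', m2 c' ∂ν := integral_const_mul _ _
      _ = r * ∫ x, χ x ^ 2 ∂(ν.prod π) := by rw [integral_prod _ hχ2]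
  have hτnn : ∀ c, 0 ≤ τ c := fun c => (integral_nonneg fun c' => mul_nonneg (hk c c') (hTnn c c')).trans (hτ c)
  have hτ'nn : ∀ c, 0 ≤ τ' c := fun c => (integral_nonneg fun c' => mul_nonneg (hk c c') (sq_nonneg _)).trans (hτ' c)
  have hAnn : 0 ≤ ∫ c, f c ^ 2 * τ c ∂ν := integral_nonneg fun c => mul_nonneg (sq_nonneg _) (hτnn c)
  have hA'nn : 0 ≤ ∫ c, f c ^ 2 * τ' c ∂ν := integral_nonneg fun c => mul_nonneg (sq_nonneg _) (hτ'nn c)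
  have hχnn : 0 ≤ ∫ x, χ x ^ 2 ∂(ν.prod π) := integral_nonneg fun _ => sq_nonneg _
  -- the AM–GM bound for every t > 0 (with `a² ≤ 2(Λ₁T + ε²)` used pointwise, so that only `hJ₁, hJ₁', hJ₂` are integrated)
  have hAMGM : ∀ t : ℝ, 0 < t → |fibredForm ν π ρ k s (fun x => f x.1 * Ω x.1 x.2) χ| ≤
      (t * (2 * (Λ₁ * (∫ c, f c ^ 2 * τ c ∂ν) + ∫ c, f c ^ 2 * τ' c ∂ν)) + t⁻¹ * (r * ∫ x, χ x ^ 2 ∂(ν.prod π))) / 2 := by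
    intro t ht
    have ht' : 0 < t⁻¹ := inv_pos.mpr ht
    have hpt2 : ∀ p : C × C, k p.1 p.2 * ((|f p.1| * a p.1 p.2) * Real.sqrt (m2 p.2)) ≤
        (t * (2 * Λ₁ * (k p.1 p.2 * T p.1 p.2 * f p.1 ^ 2) + 2 * (k p.1 p.2 * ε p.2 ^ 2 * f p.1 ^ 2)) + t⁻¹ * (k p.1 p.2 * m2 p.2)) / 2 := by
      intro p
      have hx : (|f p.1| * a p.1 p.2) * Real.sqrt (m2 p.2) ≤ (t * (|f p.1| * a p.1 p.2) ^ 2 + t⁻¹ * Real.sqrt (m2 p.2) ^ 2) / 2 := by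
        have e : (t * (|f p.1| * a p.1 p.2) ^ 2 + t⁻¹ * Real.sqrt (m2 p.2) ^ 2) / 2 - (|f p.1| * a p.1 p.2) * Real.sqrt (m2 p.2) =
            (t * (|f p.1| * a p.1 p.2) - Real.sqrt (m2 p.2)) ^ 2 / (2 * t) := by
          field_simp
          ring
        have : 0 ≤ (t * (|f p.1| * a p.1 p.2) - Real.sqrt (m2 p.2)) ^ 2 / (2 * t) := by positivity
        linarith
      have e1 : (|f p.1| * a p.1 p.2) ^ 2 = a p.1 p.2 ^ 2 * f p.1 ^ 2 := by rw [mul_pow, sq_abs]; ring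
      have e2 : Real.sqrt (m2 p.2) ^ 2 = m2 p.2 := Real.sq_sqrt (hm2nn p.2)
      rw [e1, e2] at hx
      have hy : a p.1 p.2 ^ 2 * f p.1 ^ 2 ≤ 2 * (Λ₁ * T p.1 p.2 + ε p.2 ^ 2) * f p.1 ^ 2 :=
        mul_le_mul_of_nonneg_right (hasq p.1 p.2) (sq_nonneg _)
      have hz : (|f p.1| * a p.1 p.2) * Real.sqrt (m2 p.2) ≤ (t * (2 * (Λ₁ * T p.1 p.2 + ε p.2 ^ 2) * f p.1 ^ 2) + t⁻¹ * m2 p.2) / 2 := by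
        have := mul_le_mul_of_nonneg_left hy ht.le
        linarith
      have := mul_le_mul_of_nonneg_left hz (hk p.1 p.2)
      calc k p.1 p.2 * ((|f p.1| * a p.1 p.2) * Real.sqrt (m2 p.2))
          ≤ k p.1 p.2 * ((t * (2 * (Λ₁ * T p.1 p.2 + ε p.2 ^ 2) * f p.1 ^ 2) + t⁻¹ * m2 p.2) / 2) := this
        _ = (t * (2 * Λ₁ * (k p.1 p.2 * T p.1 p.2 * f p.1 ^ 2) + 2 * (k p.1 p.2 * ε p.2 ^ 2 * f p.1 ^ 2)) + t⁻¹ * (k p.1 p.2 * m2 p.2)) / 2 := by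
            ring
    have iX : Integrable (fun p : C × C => k p.1 p.2 * T p.1 p.2 * f p.1 ^ 2) (ν.prod ν) := hJ₁
    have iY : Integrable (fun p : C × C => k p.1 p.2 * ε p.2 ^ 2 * f p.1 ^ 2) (ν.prod ν) := hJ₁'
    have iW : Integrable (fun p : C × C => k p.1 p.2 * m2 p.2) (ν.prod ν) := hJ₂
    have iX' : Integrable (fun p : C × C => 2 * Λ₁ * (k p.1 p.2 * T p.1 p.2 * f p.1 ^ 2)) (ν.prod ν) := iX.const_mul _
    have iY' : Integrable (fun p : C × C => 2 * (k p.1 p.2 * ε p.2 ^ 2 * f p.1 ^ 2)) (ν.prod ν) := iY.const_mul _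
    have i12 : Integrable (fun p : C × C => 2 * Λ₁ * (k p.1 p.2 * T p.1 p.2 * f p.1 ^ 2) + 2 * (k p.1 p.2 * ε p.2 ^ 2 * f p.1 ^ 2)) (ν.prod ν) :=
      iX'.add iY'
    have i1 : Integrable (fun p : C × C => t * (2 * Λ₁ * (k p.1 p.2 * T p.1 p.2 * f p.1 ^ 2) + 2 * (k p.1 p.2 * ε p.2 ^ 2 * f p.1 ^ 2))) (ν.prod ν) :=
      i12.const_mul t
    have i2 : Integrable (fun p : C × C => t⁻¹ * (k p.1 p.2 * m2 p.2)) (ν.prod ν) := iW.const_mul _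
    have hR : Integrable (fun p : C × C =>
        (t * (2 * Λ₁ * (k p.1 p.2 * T p.1 p.2 * f p.1 ^ 2) + 2 * (k p.1 p.2 * ε p.2 ^ 2 * f p.1 ^ 2)) + t⁻¹ * (k p.1 p.2 * m2 p.2)) / 2) (ν.prod ν) :=
      (i1.add i2).div_const 2
    have eI : ∫ p, (t * (2 * Λ₁ * (k p.1 p.2 * T p.1 p.2 * f p.1 ^ 2) + 2 * (k p.1 p.2 * ε p.2 ^ 2 * f p.1 ^ 2)) + t⁻¹ * (k p.1 p.2 * m2 p.2)) / 2 ∂(ν.prod ν)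
        = (t * (2 * Λ₁ * (∫ p, k p.1 p.2 * T p.1 p.2 * f p.1 ^ 2 ∂(ν.prod ν)) + 2 * ∫ p, k p.1 p.2 * ε p.2 ^ 2 * f p.1 ^ 2 ∂(ν.prod ν))
            + t⁻¹ * ∫ p, k p.1 p.2 * m2 p.2 ∂(ν.prod ν)) / 2 := by
      rw [integral_div, integral_add i1 i2, integral_const_mul, integral_const_mul, integral_add iX' iY', integral_const_mul, integral_const_mul]
    refine hB.trans ((integral_mono hJ hR hpt2).trans ?_)
    rw [eI]
    have h1 : t * (2 * Λ₁ * (∫ p, k p.1 p.2 * T p.1 p.2 * f p.1 ^ 2 ∂(ν.prod ν)) + 2 * ∫ p, k p.1 p.2 * ε p.2 ^ 2 * f p.1 ^ 2 ∂(ν.prod ν))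
        ≤ t * (2 * (Λ₁ * (∫ c, f c ^ 2 * τ c ∂ν) + ∫ c, f c ^ 2 * τ' c ∂ν)) := by
      refine mul_le_mul_of_nonneg_left ?_ ht.le
      have := mul_le_mul_of_nonneg_left hA hΛ₁
      linarith
    have h2 : t⁻¹ * ∫ p, k p.1 p.2 * m2 p.2 ∂(ν.prod ν) ≤ t⁻¹ * (r * ∫ x, χ x ^ 2 ∂(ν.prod π)) := mul_le_mul_of_nonneg_left hBB ht'.le
    linarith
  -- optimise in t
  have hopt := sq_le_mul_of_forall_am_gm (by positivity : (0 : ℝ) ≤ 2 * (Λ₁ * (∫ c, f c ^ 2 * τ c ∂ν) + ∫ c, f c ^ 2 * τ' c ∂ν))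
    (mul_nonneg hr hχnn) hAMGM
  calc fibredForm ν π ρ k s (fun x => f x.1 * Ω x.1 x.2) χ ^ 2
      ≤ 2 * (Λ₁ * (∫ c, f c ^ 2 * τ c ∂ν) + ∫ c, f c ^ 2 * τ' c ∂ν) * (r * ∫ x, χ x ^ 2 ∂(ν.prod π)) := hopt
    _ = 2 * r * (Λ₁ * (∫ c, f c ^ 2 * τ c ∂ν) + ∫ c, f c ^ 2 * τ' c ∂ν) * ∫ x, χ x ^ 2 ∂(ν.prod π) := by ring

end Summit.QuantumFields.YangMills.Theorems.FemtoTransferGap.FibredBO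

end
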